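import Summits.ValiantsHypothesis.ValiantsHypothesis.Theorems.KPlusLogSqLawTropicalBMarkedEdgeFourBitDominant
import Summits.ValiantsHypothesis.ValiantsHypothesis.Theorems.KPlusLogSqLawTropicalBRelabel

/-!
# Route «KPlusLogSqLaw», crux `TropicalB` (stmt-ValiantsHypothesis-19771) — the FOUR-BIT LAW FOR MARKED CELLS IN GENERAL POSITION:
# no SELECTOR design (every positive slope class on ONE cell) carries a full 4-bit binary counter, on any number of nodes

HONEST FRAMING.  Helper file (leafhand-val-kpluslogsqlaw-1 g6, 2026-08-31; `--supports stmt-ValiantsHypothesis-19771 --as helper`), refutation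
side of the crux (the cell's PolyTowers target: radix-2 odometers on polynomially many nodes for all `L`, cf. `…TropicalBBinaryCounters`).
A STRUCTURE law about one sector of designs; nothing here concerns `TropicalB` inside its window, `WeakLifting`, `Lifting`, the doors,
`MatrixDescartes` (stmt-ValiantsHypothesis-18050) or VP ≠ VNP, and no stub is closed.

THE POINT.  The tree's MARKED-EDGE FOUR-BIT LAW (`MarkedEdge.FourBit.four_bit_law_static`, `markedEdge_four_bit_law`, val-sym-trop-p4 g16) is
stated for marked LOOPS: the positive-exponent classes sit on DIAGONAL cells `(b, b)`.  Relabeling the rows by a permutation `τ`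
(`…TropicalBRelabel.isDominant_relabel_iff` with `π = τ`, `ρ = 1`: the term `(σ, λ)` of the design `v' a b l = v (τ a) b l` is the term
`(τ σ, λ)` of `v`, same weights, same presence, dominance preserved) moves the diagonal to an arbitrary GENERALIZED DIAGONAL `{(τ b, b)}`.
Hence the law holds for marked CELLS in general position:

* `four_bit_law_generalDiagonal` — static design, every present cell off the generalized diagonal `{(τ j, j)}` of exponent `0`, four marked
  columns `b₀ b₁ b₂ b₃` whose cells `(τ bᵢ, bᵢ)` have exponents `e₀ < e₁ < e₂`, `e₁ + e₂ < e₃`, every other positive-exponent marked cell used alike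
  by the four terms: NO four dominant terms use the marked cells in the patterns `{0,1,2}`, `{0,3}`, `{1,3}`, `{2,3}`.
* `markedCell_four_bit_law` — the SELECTOR SECTOR verbatim (format `(m, 5)`, `d = (0,1,2,4,8)`, class `n + 1` present only on the cell `(τ n, n)`
  for `n < 4`, class `0` only on every other cell; ANY `τ`, ANY support and valuations, EVERY `m ≥ 4`): the patterns `{0,1,2}, {0,3}, {1,3}, {2,3}`
  of used marked cells are never simultaneously dominant.  COROLLARY: no full 4-bit counter exists in ANY design in which each of four classes of
  slopes `1, 2, 4, 8` is present on exactly one cell — if two of the four cells share a row or a column the pattern using both is not even present,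
  and otherwise the four cells lie on a generalized diagonal.  So every «selector» architecture (a bit = one dedicated cell; e.g. the
  route/junction designs, row-selector designs, displacement gadgets) is closed off at `L = 4`, whatever the auxiliary structure: binary-counter
  FAMILIES must let classes MIGRATE between cells (as the located `L ≤ 6` cubes of `…TropicalBBinaryCounters` / `…BinaryCounterSix` do).

[folklore] (row relabeling of the tree's theorem; no citation exists — the four-bit law is the cell's own).
-/

set_option linter.dupNamespace false
set_option autoImplicit false

namespace Summit.ValiantsHypothesis.ValiantsHypothesis.Theorems.KPlusLogSqLaw
namespace MarkedCell

open Finset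
open Summit.ValiantsHypothesis.ValiantsHypothesis.Theorems.MatrixDescartes.Negative

variable {m K : ℕ}

/-- **Dominance under a ROW relabeling** (the case `ρ = 1` of `isDominant_relabel_iff`): the term `p = (σ, λ)` is dominant for `(d, v, ε)` at `θ`
iff the term `(τ⁻¹ σ, λ)` is dominant for the row-relabeled design `v' a b l = v (τ a) b l`, `ε' a b l = ε (τ a) b l`. [folklore] -/
theorem isDominant_rowRelabel_iff (d : Fin K → ℕ) (v ε : Fin m → Fin m → Fin K → ℤ) (τ : Equiv.Perm (Fin m))
    (p : Equiv.Perm (Fin m) × (Fin m → Fin K)) (θ : ℤ) :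
    IsDominant d v ε θ p ↔
      IsDominant d (fun a b l => v (τ a) b l) (fun a b l => ε (τ a) b l) θ (τ⁻¹ * p.1, p.2) := by
  have h := isDominant_relabel_iff d v ε τ 1 (τ⁻¹ * p.1, p.2) θ
  have e1 : ((τ * (τ⁻¹ * p.1) * (1 : Equiv.Perm (Fin m))⁻¹ : Equiv.Perm (Fin m)),
      fun j => p.2 ((1 : Equiv.Perm (Fin m))⁻¹ j)) = p := by
    refine Prod.ext ?_ (funext fun j => ?_)
    · simp
    · simp
  rw [e1] at h
  exact h

/-- **FOUR-BIT LAW ON A GENERALIZED DIAGONAL.**  Static design (`cl i j` = the class of cell `(i, j)`); the present cells OFF the generalized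
diagonal `{(τ j, j)}` have exponent `0`; four marked columns `b₀, b₁, b₂, b₃` whose diagonal cells `(τ bᵢ, bᵢ)` have exponents
`e₀ < e₁ < e₂` and `e₁ + e₂ < e₃`; every other column whose generalized-diagonal cell has non-zero exponent is used alike by the four terms.
Then no four dominant terms (at any four integer slopes) use the marked cells in the patterns «`b₀,b₁,b₂` not `b₃`», «`b₀,b₃` not `b₁,b₂`»,
«`b₁,b₃` not `b₀,b₂`», «`b₂,b₃` not `b₀,b₁`» (a term `p` uses the marked cell of column `b` iff `p.1 b = τ b`).
Proof: `MarkedEdge.FourBit.four_bit_law_static` for the row-relabeled design. [folklore] -/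
theorem four_bit_law_generalDiagonal (d : Fin K → ℕ) (v ε : Fin m → Fin m → Fin K → ℤ) (cl : Fin m → Fin m → Fin K)
    (τ : Equiv.Perm (Fin m))
    (hstatic : ∀ i j l, ε i j l ≠ 0 → l = cl i j) (hoff : ∀ i j, i ≠ τ j → ε i j (cl i j) ≠ 0 → d (cl i j) = 0)
    {b₀ b₁ b₂ b₃ : Fin m} (hs01 : d (cl (τ b₀) b₀) < d (cl (τ b₁) b₁)) (hs12 : d (cl (τ b₁) b₁) < d (cl (τ b₂) b₂))
    (hs3 : d (cl (τ b₁) b₁) + d (cl (τ b₂) b₂) < d (cl (τ b₃) b₃))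
    {θD θA θB θC : ℤ} {pD pA pB pC : Equiv.Perm (Fin m) × (Fin m → Fin K)}
    (hD : IsDominant d v ε θD pD) (hA : IsDominant d v ε θA pA) (hB : IsDominant d v ε θB pB) (hC : IsDominant d v ε θC pC)
    (hD0 : pD.1 b₀ = τ b₀) (hD1 : pD.1 b₁ = τ b₁) (hD2 : pD.1 b₂ = τ b₂) (hD3 : pD.1 b₃ ≠ τ b₃)
    (hA0 : pA.1 b₀ = τ b₀) (hA1 : pA.1 b₁ ≠ τ b₁) (hA2 : pA.1 b₂ ≠ τ b₂) (hA3 : pA.1 b₃ = τ b₃)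
    (hB0 : pB.1 b₀ ≠ τ b₀) (hB1 : pB.1 b₁ = τ b₁) (hB2 : pB.1 b₂ ≠ τ b₂) (hB3 : pB.1 b₃ = τ b₃)
    (hC0 : pC.1 b₀ ≠ τ b₀) (hC1 : pC.1 b₁ ≠ τ b₁) (hC2 : pC.1 b₂ = τ b₂) (hC3 : pC.1 b₃ = τ b₃)
    (hctx : ∀ i, i ≠ b₀ → i ≠ b₁ → i ≠ b₂ → i ≠ b₃ → d (cl (τ i) i) ≠ 0 →
      (pA.1 i = τ i ↔ pD.1 i = τ i) ∧ (pB.1 i = τ i ↔ pD.1 i = τ i) ∧ (pC.1 i = τ i ↔ pD.1 i = τ i)) : False := by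
  -- the row-relabeled design and its class table
  have key : ∀ (p : Equiv.Perm (Fin m) × (Fin m → Fin K)) (b : Fin m), ((τ⁻¹ * p.1) b = b ↔ p.1 b = τ b) := by
    intro p b
    rw [Equiv.Perm.mul_apply, Equiv.Perm.inv_def, Equiv.symm_apply_eq]
  have hD' := (isDominant_rowRelabel_iff d v ε τ pD θD).mp hD
  have hA' := (isDominant_rowRelabel_iff d v ε τ pA θA).mp hA
  have hB' := (isDominant_rowRelabel_iff d v ε τ pB θB).mp hB
  have hC' := (isDominant_rowRelabel_iff d v ε τ pC θC).mp hC
  refine MarkedEdge.FourBit.four_bit_law_static d (fun a b l => v (τ a) b l) (fun a b l => ε (τ a) b l) (fun a b => cl (τ a) b)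
    (fun i j l h => hstatic (τ i) j l h) (fun i j hij h => hoff (τ i) j (fun e => hij (τ.injective e)) h)
    (b₀ := b₀) (b₁ := b₁) (b₂ := b₂) (b₃ := b₃) hs01 hs12 hs3 hD' hA' hB' hC'
    ((key pD b₀).mpr hD0) ((key pD b₁).mpr hD1) ((key pD b₂).mpr hD2) (fun h => hD3 ((key pD b₃).mp h))
    ((key pA b₀).mpr hA0) (fun h => hA1 ((key pA b₁).mp h)) (fun h => hA2 ((key pA b₂).mp h)) ((key pA b₃).mpr hA3)
    (fun h => hB0 ((key pB b₀).mp h)) ((key pB b₁).mpr hB1) (fun h => hB2 ((key pB b₂).mp h)) ((key pB b₃).mpr hB3)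
    (fun h => hC0 ((key pC b₀).mp h)) (fun h => hC1 ((key pC b₁).mp h)) ((key pC b₂).mpr hC2) ((key pC b₃).mpr hC3)
    ?_
  intro i h0 h1 h2 h3 hdi
  obtain ⟨ha, hb, hc⟩ := hctx i h0 h1 h2 h3 hdi
  simp only [key]
  exact ⟨ha, hb, hc⟩

/-- **THE FOUR-BIT LAW IN THE SELECTOR SECTOR** (format `(m, 5)`, exponents `d = (0, 1, 2, 4, 8)`; for a permutation `τ` of the rows, a present
class on cell `(i, j)` is class `j + 1` if `i = τ j` and `j < 4` — the four MARKED CELLS `(τ 0, 0), …, (τ 3, 3)`, slopes `1, 2, 4, 8`, in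
general position — and class `0` otherwise; ANY `τ`, ANY support, ANY valuations, EVERY size `m ≥ 4`).  There are no four terms, dominant at
four integer slopes, whose sets of used marked cells are `{0,1,2}` (slope 7), `{0,3}` (9), `{1,3}` (10), `{2,3}` (12); in particular NO FULL
4-BIT COUNTER lives in any selector design, on any number of auxiliary nodes.  (`τ = 1` is `MarkedEdge.FourBit.markedEdge_four_bit_law`.)
[folklore: row relabeling of the cell's theorem] -/
theorem markedCell_four_bit_law (m : ℕ) (hm : 4 ≤ m) (τ : Equiv.Perm (Fin m)) (d : Fin 5 → ℕ)
    (hd : ∀ l : Fin 5, d l = if (l : ℕ) = 0 then 0 else 2 ^ ((l : ℕ) - 1)) (v ε : Fin m → Fin m → Fin 5 → ℤ)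
    (hsec : ∀ (i j : Fin m) (l : Fin 5), ε i j l ≠ 0 → (l : ℕ) = if i = τ j ∧ (j : ℕ) < 4 then (j : ℕ) + 1 else 0) :
    ¬ ∃ (θ : Fin 4 → ℤ) (p : Fin 4 → Equiv.Perm (Fin m) × (Fin m → Fin 5)),
      (∀ k, IsDominant d v ε (θ k) (p k)) ∧
      ∀ n : Fin m, (n : ℕ) < 4 →
        ((p 0).1 n = τ n ↔ (n : ℕ) ≠ 3) ∧ ((p 1).1 n = τ n ↔ ((n : ℕ) = 0 ∨ (n : ℕ) = 3)) ∧
        ((p 2).1 n = τ n ↔ ((n : ℕ) = 1 ∨ (n : ℕ) = 3)) ∧ ((p 3).1 n = τ n ↔ ((n : ℕ) = 2 ∨ (n : ℕ) = 3)) := by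
  rintro ⟨θ, p, hdom, hpat⟩
  have key : ∀ (q : Equiv.Perm (Fin m) × (Fin m → Fin 5)) (b : Fin m), ((τ⁻¹ * q.1) b = b ↔ q.1 b = τ b) := by
    intro q b
    rw [Equiv.Perm.mul_apply, Equiv.Perm.inv_def, Equiv.symm_apply_eq]
  -- the row-relabeled design is in the marked-LOOP sector
  have hsec' : ∀ (i j : Fin m) (l : Fin 5), ε (τ i) j l ≠ 0 → (l : ℕ) = if i = j ∧ (i : ℕ) < 4 then (i : ℕ) + 1 else 0 := by
    intro i j l h
    rw [hsec (τ i) j l h]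
    by_cases hij : i = j
    · subst hij
      simp
    · rw [if_neg (fun hh => hij (τ.injective hh.1)), if_neg (fun hh => hij hh.1)]
  refine MarkedEdge.FourBit.markedEdge_four_bit_law m hm d hd (fun a b l => v (τ a) b l) (fun a b l => ε (τ a) b l) hsec'
    ⟨θ, fun k => (τ⁻¹ * (p k).1, (p k).2), fun k => (isDominant_rowRelabel_iff d v ε τ (p k) (θ k)).mp (hdom k), ?_⟩
  intro n hn
  obtain ⟨q0, q1, q2, q3⟩ := hpat n hn
  simp only [key]
  exact ⟨q0, q1, q2, q3⟩

end MarkedCell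
end Summit.ValiantsHypothesis.ValiantsHypothesis.Theorems.KPlusLogSqLaw
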